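import Summits.Langlands.Langlands.Theses.RamifiedCoefficientSeed
import Summits.Langlands.Langlands.Theses.PrimeSwitchSplit
import HarnessLib

/-!
# Birth skeleton (BC3) for the split child `WeakGeometricAutomorphy` of `RamifiedCoefficientSeed.SectorComplement`
(crux-strategist cstrat-stmt-Langlands-16781-r1, 2026-08-17; child item: stmt-Langlands-17414 (verbatim; attached child of 16781))

B_w = Fontaine–Mazur–Langlands in a.e. form.  Split by RANK (route PrimeSwitchSplit's foreseen layer-2 split of this very item,
"B_w ⇐ RankOne → HigherRank"): rank one = de Rham characters are algebraic Hecke characters at Satake level (class field theory +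
Weil; nearly in tree via the `RankOne*.lean` files: size M–L); rank ≥ 2 = the open core (automorphy lifting in the regular,
residually adequate, totally-real/CM regimes; wide open for irregular weights / general fields: size open-problem).

BY-NAME VERSION: the child item is SHARED — it is stmt-level identical to `Summit.Langlands.Langlands.Theses.PrimeSwitchSplit.WeakGeometricAutomorphy`
(an existing decl), so this skeleton concludes THAT decl by name (`open … PrimeSwitchSplit (WeakGeometricAutomorphy)`); after `route edit --split` the
homonymous `RamifiedCoefficientSeed.WeakGeometricAutomorphy` is definitionally the same term.  Register with
`ledger skeleton check <this file> --crux <child item> --crux-decl Summit.Langlands.Langlands.Theses.PrimeSwitchSplit.WeakGeometricAutomorphy`.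
`lean check`: rc 0, sorries = the `stub_*` only; `WeakGeometricAutomorphy_of` concludes the child BY NAME.
-/

noncomputable section

set_option linter.dupNamespace false

namespace Summit.Langlands.Langlands.Cruxes.SectorComplement.BirthWeakGeometricAutomorphy

open scoped NumberField Classical Topology
open Filter IsDedekindDomain
open Literature.NumberTheory.Automorphic Literature.NumberTheory.GaloisRepresentations
open Summit.Langlands

open Summit.Langlands.Langlands.Theses.PrimeSwitchSplit (WeakGeometricAutomorphy)

/-- **stub RANK ONE** — a de Rham (hence locally algebraic) `ℓ`-adic character of `Γ_K`, unramified a.e., is the avatar of an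
L-algebraic Hecke character of `GL₁(𝔸_K)` at Satake level (class field theory + Weil 1956 / Serre's abelian `ℓ`-adic
representations III.2; Fontaine–Mazur for `n = 1`).  Why plausibly true: a THEOREM of the literature; in tree nearly reachable
from `RankOne*.lean` / `WeakExistenceNormTwist`.  Size M–L.
[cite: SerreAbelianLadic1968, Ch. III §2] [cite: FontaineMazurGeometric1995, §1] -/
theorem stub_rankOne : ∀ (K : Type) [Field K] [NumberField K] (hcpt : Literature.NumberTheory.Automorphic.isCompact_glFiniteIntegralLevel 1 K) (ℓ : ℕ) [Fact ℓ.Prime] (ι : PadicAlgCl ℓ ≃+* ℂ) (ρ : Literature.NumberTheory.GaloisRepresentations.FramedGaloisRep K (PadicAlgCl ℓ) 1), ρ.toGaloisRep.IsIrreducible → ((∀ᶠ v : IsDedekindDomain.HeightOneSpectrum (NumberField.RingOfIntegers K) in cofinite, ρ.IsUnramifiedAt v) ∧ ∀ (v : IsDedekindDomain.HeightOneSpectrum (NumberField.RingOfIntegers K)) (hv : ((ℓ : ℕ) : NumberField.RingOfIntegers K) ∈ v.asIdeal), (Literature.NumberTheory.PAdicHodge.fontainePstAdicCompletion v ℓ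 hv).IsDeRhamFramed (ρ.toLocal v)) → ∃ π : Literature.NumberTheory.Automorphic.CuspidalAutomorphicRepData 1 K hcpt, π.1.IsLAlgebraic ∧ ∀ᶠ v : IsDedekindDomain.HeightOneSpectrum (NumberField.RingOfIntegers K) in cofinite, SatakeFrobCompatibleAt ι π.1 ρ v := by
  sorry

/-- **stub HIGHER RANK** — B_w for `n ≥ 2`: every irreducible, a.e.-unramified, pinned-de-Rham `ρ : Γ_K → GL_n(ℚ̄_ℓ)`,
`n ≥ 2`, is Satake–Frobenius compatible a.e. with an L-algebraic cuspidal `π`.  OPEN (known: odd `GL₂/ℚ` by Khare–Wintenberger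
+ Kisin + Emerton + Pan; regular weights under lifting provisos, BLGGT potential / ACC+ / BCGP; nothing for irregular weights,
even `GL₂/ℚ`, general `K`).  Why it might fail: it is the open core of direction (B).  Size open-problem.
[cite: FontaineMazurGeometric1995, Conj. 1] [cite: KhareWintenberger2009, Thm. 1.2] [cite: ACCGHLNSTT2023, Thm. 6.1.1] -/
theorem stub_higherRank : ∀ (K : Type) [Field K] [NumberField K] (n : ℕ) (hcpt : Literature.NumberTheory.Automorphic.isCompact_glFiniteIntegralLevel n K), 2 ≤ n → ∀ (ℓ : ℕ) [Fact ℓ.Prime] (ι : PadicAlgCl ℓ ≃+* ℂ) (ρ : Literature.NumberTheory.GaloisRepresentations.FramedGaloisRep K (PadicAlgCl ℓ) n), ρ.toGaloisRep.IsIrreducible → ((∀ᶠ v : IsDedekindDomain.HeightOneSpectrum (NumberField.RingOfIntegers K) in cofinite, ρ.IsUnramifiedAt v) ∧ ∀ (v : IsDedekindDomain.HeightOneSpectrum (NumberField.RingOfIntegers K)) (hv : ((ℓ : ℕ) : NumberField.RingOfIntegers K) ∈ v.asIdeal), (Literature.NumberTheory.PAdicHodge.fontainePstAdicCompletion v ℓ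 hv).IsDeRhamFramed (ρ.toLocal v)) → ∃ π : Literature.NumberTheory.Automorphic.CuspidalAutomorphicRepData n K hcpt, π.1.IsLAlgebraic ∧ ∀ᶠ v : IsDedekindDomain.HeightOneSpectrum (NumberField.RingOfIntegers K) in cofinite, SatakeFrobCompatibleAt ι π.1 ρ v := by
  sorry

namespace _Goal

/-- The statement of `stub_rankOne` (literally its type). [folklore] -/
def stub_rankOne : Prop :=
  type_of% @Summit.Langlands.Langlands.Cruxes.SectorComplement.BirthWeakGeometricAutomorphy.stub_rankOne

/-- The statement of `stub_higherRank` (literally its type). [folklore] -/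
def stub_higherRank : Prop :=
  type_of% @Summit.Langlands.Langlands.Cruxes.SectorComplement.BirthWeakGeometricAutomorphy.stub_higherRank

end _Goal

/-- **B_w from its two stubs**: case split on the rank. -/
theorem WeakGeometricAutomorphy_of (h1 : _Goal.stub_rankOne) (h2 : _Goal.stub_higherRank) : WeakGeometricAutomorphy := by
  dsimp only [_Goal.stub_rankOne, _Goal.stub_higherRank] at h1 h2
  intro K _ _ n hcpt hn ℓ _ ι ρ hirr hgeo
  by_cases hn1 : n = 1
  · subst hn1
    exact h1 K hcpt ℓ ι ρ hirr hgeo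
  · exact h2 K n hcpt (by omega) ℓ ι ρ hirr hgeo

/-- by-name sanity check -/
example : WeakGeometricAutomorphy := WeakGeometricAutomorphy_of stub_rankOne stub_higherRank

end Summit.Langlands.Langlands.Cruxes.SectorComplement.BirthWeakGeometricAutomorphy

end
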